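import Summits.QuantumFields.YangMills.Theorems.BalabanUVNodesN15KingModelConstantLinkPlaneWaves
import Summits.QuantumFields.YangMills.Theorems.BalabanUVNodesN15KingModelCurvatureBoundedBelow
import HarnessLib

/-!
# BalabanUVNodes ∕ N15 — THE KING-MODEL RUNG (PART Ϸ-c): THE PAULI PAIR — the constant `SU(2)` link field `W_{ν₀} = e^{iaσ₁}`, `W_{ν₁} = e^{ibσ₂}` (flat elsewhere): Pauli algebra,
# unitarity, the commutator `[e^{iaσ₁}, e^{ibσ₂}] = −2i·sin a·sin b·σ₃`, the plaquette `P = W_aW_bW_a^*W_b^*` with `‖Pu − u‖ = 2|sin a sin b|·‖u‖` and `Re⟪u,Pu⟫ = (1 − 2sin²a sin²b)‖u‖²`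
# EXACTLY (constant non-abelian curvature), the one-direction fibre norm `‖ξ − ψ·e^{iaσ}ξ‖² = 2(1 − Re ψ·cos a)‖ξ‖² + 2·Im ψ·sin a·⟨σ⟩_ξ` and the Bloch constraint `⟨σ₁⟩² + ⟨σ₂⟩² ≤ ‖ξ‖⁴`
# (Track A, DAG node N15 = NE2; FAN-OUT v1.1 §N15 s3 «KING-MODEL RUNG … + what the curved case adds»; count-neutral)

HONEST FRAMING.  Count-neutral (cell `pub-ymgap`, seat `pub-ymgap-dag-n15-e` g48; `--supports stmt-QuantumFields-27247 --as helper` = K3ᴬ, KEY MAP v3).  Elementary `2 × 2` matrix algebra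
for the simplest genuinely NON-ABELIAN constant link field on King's torus (door (t3⁵³) of the desk); the objects feed PART Ϸ-d (the gap) and Ϸ-e (tightness).  NOT Bałaban's `G_k(U)`;
NOT a node discharge (N15 of record untouched); nothing continuum ∕ ℝ⁴ ∕ OS ∕ Clay.  The plaquette variables are King's own ([King1986] (2.12) p.653: `U(∂p) = Π_{b∈∂p}U(b)`), here
matrix-valued; the covariant difference is [Balaban1985BackgroundPropagators] (3.3) p.391.

THE RESULTS:
* §1 `pauliX`, `pauliY`, `pauliZ` (`σ₁,σ₂,σ₃`), `rotX a = e^{iaσ₁} = cos a·1 + i sin a·σ₁`, `rotY b = e^{ibσ₂}` (a REAL rotation), squares ∕ anticommutation ∕ `σ₁σ₂ = iσ₃`, Hermitian, unitary;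
  ★ **`rotX_mul_rotY_sub`** (`e^{iaσ₁}e^{ibσ₂} − e^{ibσ₂}e^{iaσ₁} = −2i sin a sin b·σ₃`: the links COMMUTE iff `sin a·sin b = 0`);
* §2 `pauliLink a b ν₀ ν₁ : Fin(d+1) → U(2)` (`W_{ν₀} = e^{iaσ₁}`, `W_{ν₁} = e^{ibσ₂}`, `W_μ = 1` otherwise), `pauliLink_mem_unitaryGroup`; the plaquette of a constant field `kingPlaq_kingConstLink`
  (`= W_μW_νW_μ^*W_ν^*`, every site), `plaq_sub_one_eq` (`ABA^*B^* − 1 = [A,B]·A^*B^*` for unitary `A,B`), ★★ **`norm_kingPlaq_pauli_sub_self`** (`‖Pu − u‖ = 2|sin a sin b|·‖u‖` for EVERY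
  `u`: the field has CONSTANT CURVATURE, plaquette angle `θ_P` with `sin(θ_P∕2) = |sin a sin b|`), ★★ **`re_inner_kingPlaq_pauli`** (`Re⟪u,Pu⟫ = (1 − 2sin²a sin²b)‖u‖²`: the numerical
  range of `P` is the single point `cos θ_P` on the real axis — Ϳ-b's `γ` is attained, not estimated);
* §3 ★★ **`re_quadForm_covLapF_pauliLink_ge_plaq`** — PART Ϳ's PLAQUETTE ROAD BY NAME (Ϳ-c `re_quadForm_covLapF_ge_of_holonomy_gap` at `s = 2|sin a sin b|`):
  `(m² + 2c·λ(1 − 2sin²a sin²b))·Σ‖v_x‖² ≤ Re⟨v,(−cΔ_W+m²)v⟩`, `λ = plaqGap` (`= 2 − 2cos(θ_P∕4) ≈ sin²a sin²b∕4`): QUADRATIC in the curvature — the benchmark PART Ϸ-d beats;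
* §4 THE FIBRE LETTERS for Ϸ-d: ★ `im_inner_toEuclideanLin_of_isHermitian` (`⟨σ⟩_ξ` is real), ★★ **`norm_sq_sub_smul_rot`** (for `W = cos a·1 + i sin a·σ`, `σ` Hermitian unitary, `|ψ| = 1`:
  `‖ξ − ψ·Wξ‖² = 2(1 − Re ψ cos a)‖ξ‖² + 2·Im ψ·sin a·Re⟪ξ,σξ⟫`), its instances `norm_sq_sub_smul_rotX`∕`_rotY`, ★ `re_inner_pauliX`∕`re_inner_pauliY` (`⟨σ₁⟩ = 2Re(ξ̄₀ξ₁)`,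
  `⟨σ₂⟩ = 2Im(ξ̄₀ξ₁)`), ★★ **`bloch_sq_le`** (`⟨σ₁⟩_ξ² + ⟨σ₂⟩_ξ² ≤ ‖ξ‖⁴`, i.e. `4|ξ₀|²|ξ₁|² ≤ (|ξ₀|²+|ξ₁|²)²`).
PRIOR TREE ART (by name): Ϸ-a (`kingConstLink`), Ͱ-a (`covLapF`), Ͱ-b (`fib`, `norm_toEuclideanLin_of_mem_unitaryGroup`), Ͻ-q (`kingPlaq`), Ϳ-a (`plaqGap`), Ϳ-c (`re_quadForm_covLapF_ge_of_holonomy_gap`),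
Mathlib (`Matrix.unitaryGroup`, `IsHermitian.im_star_dotProduct_mulVec_self`, `norm_sub_sq`, `inner_self_eq_norm_sq_to_K`).  Dedup (rg at filing): `rg -il pauli` over `Summits/QuantumFields`
+ `Literature/MathematicalPhysics` = QuantumChemistry files only (no `Matrix (Fin 2) (Fin 2) ℂ` Pauli matrices in the tree's QFT library); needles `pauliX|rotX|pauliLink|bloch_sq_le|norm_sq_sub_smul_rot`
0 tree files.  Locators: [King1986] (2.12) p.653, (4.4) p.670; [Balaban1985BackgroundPropagators] (3.3) p.391, (3.23) p.394; [DodziukMathai2006] §1 Cor 1.3 (notion).  0 `sorry`, 6 `def`.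
-/

noncomputable section

open scoped BigOperators ComplexConjugate ComplexOrder InnerProductSpace
open Finset Matrix WithLp

namespace Summit.QuantumFields.YangMills.BalabanUVNodes.N15KingModelRung.ConstantCurvature

open Literature.MathematicalPhysics.QuantumFieldTheory.Balaban1983to89.B5Prop11Plancherel (Tor unitVec chi)
open Summit.QuantumFields.YangMills.BalabanUVNodes.N15KingModelRung.Covariant (covLapF fib fib_apply norm_toEuclideanLin_of_mem_unitaryGroup)
open Summit.QuantumFields.YangMills.BalabanUVNodes.N15KingModelRung.Cover (kingPlaq)
open Summit.QuantumFields.YangMills.BalabanUVNodes.N15KingModelRung.Curvature (plaqGap re_quadForm_covLapF_ge_of_holonomy_gap kingPlaq_mem_unitaryGroup)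

/-! ## §1 Pauli matrices and the two one-parameter groups -/

section Pauli

/-- `σ₁ = [[0,1],[1,0]]`. [folklore] -/
def pauliX : Matrix (Fin 2) (Fin 2) ℂ := !![0, 1; 1, 0]
/-- `σ₂ = [[0,−i],[i,0]]`. [folklore] -/
def pauliY : Matrix (Fin 2) (Fin 2) ℂ := !![0, -Complex.I; Complex.I, 0]
/-- `σ₃ = [[1,0],[0,−1]]`. [folklore] -/
def pauliZ : Matrix (Fin 2) (Fin 2) ℂ := !![1, 0; 0, -1]
/-- `e^{iaσ₁} = [[cos a, i sin a],[i sin a, cos a]]`. [folklore] -/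
def rotX (a : ℝ) : Matrix (Fin 2) (Fin 2) ℂ := !![(Real.cos a : ℂ), Real.sin a * Complex.I; Real.sin a * Complex.I, Real.cos a]
/-- `e^{ibσ₂} = [[cos b, sin b],[−sin b, cos b]]` (a real rotation). [folklore] -/
def rotY (b : ℝ) : Matrix (Fin 2) (Fin 2) ℂ := !![(Real.cos b : ℂ), Real.sin b; -Real.sin b, Real.cos b]

/-- `σ₁² = 1`. [folklore] -/
theorem pauliX_mul_self : pauliX * pauliX = 1 := by
  ext i j; fin_cases i <;> fin_cases j <;> simp [pauliX, Matrix.mul_apply, Fin.sum_univ_two]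
/-- `σ₂² = 1`. [folklore] -/
theorem pauliY_mul_self : pauliY * pauliY = 1 := by
  ext i j; fin_cases i <;> fin_cases j <;> simp [pauliY, Matrix.mul_apply, Fin.sum_univ_two]
/-- `σ₃² = 1`. [folklore] -/
theorem pauliZ_mul_self : pauliZ * pauliZ = 1 := by
  ext i j; fin_cases i <;> fin_cases j <;> simp [pauliZ, Matrix.mul_apply, Fin.sum_univ_two]
/-- `σ₁σ₂ = iσ₃`. [folklore] -/
theorem pauliX_mul_pauliY : pauliX * pauliY = Complex.I • pauliZ := by
  ext i j; fin_cases i <;> fin_cases j <;> simp [pauliX, pauliY, pauliZ, Matrix.mul_apply, Fin.sum_univ_two]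
/-- `σ₂σ₁ = −iσ₃` (anticommutation). [folklore] -/
theorem pauliY_mul_pauliX : pauliY * pauliX = -(Complex.I • pauliZ) := by
  ext i j; fin_cases i <;> fin_cases j <;> simp [pauliX, pauliY, pauliZ, Matrix.mul_apply, Fin.sum_univ_two]
/-- `σ₁` is Hermitian. [folklore] -/
theorem isHermitian_pauliX : pauliX.IsHermitian := by
  show pauliXᴴ = pauliX
  ext i j; fin_cases i <;> fin_cases j <;> simp [pauliX, Matrix.conjTranspose_apply]
/-- `σ₂` is Hermitian. [folklore] -/
theorem isHermitian_pauliY : pauliY.IsHermitian := by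
  show pauliYᴴ = pauliY
  ext i j; fin_cases i <;> fin_cases j <;> simp [pauliY, Matrix.conjTranspose_apply]
/-- `σ₃` is Hermitian. [folklore] -/
theorem isHermitian_pauliZ : pauliZ.IsHermitian := by
  show pauliZᴴ = pauliZ
  ext i j; fin_cases i <;> fin_cases j <;> simp [pauliZ, Matrix.conjTranspose_apply]
/-- `σ₁ ∈ U(2)`. [folklore] -/
theorem pauliX_mem_unitaryGroup : pauliX ∈ Matrix.unitaryGroup (Fin 2) ℂ := by
  rw [Matrix.mem_unitaryGroup_iff, Matrix.star_eq_conjTranspose, isHermitian_pauliX.eq, pauliX_mul_self]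
/-- `σ₂ ∈ U(2)`. [folklore] -/
theorem pauliY_mem_unitaryGroup : pauliY ∈ Matrix.unitaryGroup (Fin 2) ℂ := by
  rw [Matrix.mem_unitaryGroup_iff, Matrix.star_eq_conjTranspose, isHermitian_pauliY.eq, pauliY_mul_self]
/-- `σ₃ ∈ U(2)`. [folklore] -/
theorem pauliZ_mem_unitaryGroup : pauliZ ∈ Matrix.unitaryGroup (Fin 2) ℂ := by
  rw [Matrix.mem_unitaryGroup_iff, Matrix.star_eq_conjTranspose, isHermitian_pauliZ.eq, pauliZ_mul_self]

/-- `e^{iaσ₁} = cos a·1 + (i sin a)·σ₁`. [folklore] -/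
theorem rotX_eq (a : ℝ) : rotX a = (Real.cos a : ℂ) • (1 : Matrix (Fin 2) (Fin 2) ℂ) + ((Real.sin a : ℂ) * Complex.I) • pauliX := by
  ext i j; fin_cases i <;> fin_cases j <;> simp [rotX, pauliX]
/-- `e^{ibσ₂} = cos b·1 + (i sin b)·σ₂`. [folklore] -/
theorem rotY_eq (b : ℝ) : rotY b = (Real.cos b : ℂ) • (1 : Matrix (Fin 2) (Fin 2) ℂ) + ((Real.sin b : ℂ) * Complex.I) • pauliY := by
  ext i j; fin_cases i <;> fin_cases j <;> simp [rotY, pauliY, mul_assoc]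

/-- `cos² + sin² = 1` in `ℂ`. [folklore] -/
theorem cos_sq_add_sin_sq_complex (a : ℝ) : (Real.cos a : ℂ) ^ 2 + (Real.sin a : ℂ) ^ 2 = 1 := by exact_mod_cast Real.cos_sq_add_sin_sq a

/-- `(e^{iaσ₁})^* = e^{−iaσ₁}` entrywise: `[[cos a, −i sin a],[−i sin a, cos a]]`. [folklore] -/
theorem conjTranspose_rotX (a : ℝ) : (rotX a)ᴴ = !![(Real.cos a : ℂ), -(Real.sin a * Complex.I); -(Real.sin a * Complex.I), Real.cos a] := by
  ext i j; fin_cases i <;> fin_cases j <;> simp [rotX, Matrix.conjTranspose_apply, Complex.conj_ofReal, -Complex.ofReal_cos, -Complex.ofReal_sin]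
/-- `(e^{ibσ₂})^* = e^{−ibσ₂}` = the transpose rotation. [folklore] -/
theorem conjTranspose_rotY (b : ℝ) : (rotY b)ᴴ = !![(Real.cos b : ℂ), -Real.sin b; Real.sin b, Real.cos b] := by
  ext i j; fin_cases i <;> fin_cases j <;> simp [rotY, Matrix.conjTranspose_apply, Complex.conj_ofReal, -Complex.ofReal_cos, -Complex.ofReal_sin]

/-- ★ `e^{iaσ₁} ∈ U(2)`. [folklore] -/
theorem rotX_mem_unitaryGroup (a : ℝ) : rotX a ∈ Matrix.unitaryGroup (Fin 2) ℂ := by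
  rw [Matrix.mem_unitaryGroup_iff, Matrix.star_eq_conjTranspose, conjTranspose_rotX]
  have h := cos_sq_add_sin_sq_complex a
  ext i j; fin_cases i <;> fin_cases j <;> simp [rotX, Matrix.mul_apply, Fin.sum_univ_two, -Complex.ofReal_cos, -Complex.ofReal_sin] <;> ring_nf <;>
    simp only [Complex.I_sq] <;> linear_combination h
/-- ★ `e^{ibσ₂} ∈ U(2)`. [folklore] -/
theorem rotY_mem_unitaryGroup (b : ℝ) : rotY b ∈ Matrix.unitaryGroup (Fin 2) ℂ := by
  rw [Matrix.mem_unitaryGroup_iff, Matrix.star_eq_conjTranspose, conjTranspose_rotY]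
  have h := cos_sq_add_sin_sq_complex b
  ext i j; fin_cases i <;> fin_cases j <;> simp [rotY, Matrix.mul_apply, Fin.sum_univ_two, -Complex.ofReal_cos, -Complex.ofReal_sin] <;> ring_nf <;> linear_combination h

/-- ★ **THE COMMUTATOR OF THE TWO LINKS**: `e^{iaσ₁}e^{ibσ₂} − e^{ibσ₂}e^{iaσ₁} = (−2i·sin a·sin b)·σ₃` — the links commute iff `sin a·sin b = 0`. [folklore] -/
theorem rotX_mul_rotY_sub (a b : ℝ) : rotX a * rotY b - rotY b * rotX a = (-(2 : ℂ) * Complex.I * Real.sin a * Real.sin b) • pauliZ := by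
  ext i j; fin_cases i <;> fin_cases j <;> simp [rotX, rotY, pauliZ] <;> ring

end Pauli

/-! ## §2 The Pauli link field, its plaquette, its constant curvature -/

section Plaquette

variable {d : ℕ} (K : Fin (d + 1) → ℕ)

/-- THE PAULI LINK FIELD (constant): `W_{ν₀} = e^{iaσ₁}`, `W_{ν₁} = e^{ibσ₂}`, `W_μ = 1` for every other direction. [cite: King1986, (2.12) p.653; Balaban1985BackgroundPropagators, (3.3) p.391] -/
def pauliLink (a b : ℝ) (ν₀ ν₁ : Fin (d + 1)) : Fin (d + 1) → Matrix (Fin 2) (Fin 2) ℂ :=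
  fun μ => if μ = ν₀ then rotX a else if μ = ν₁ then rotY b else 1

/-- `W_{ν₀} = e^{iaσ₁}`. [folklore] -/
@[simp] theorem pauliLink_fst (a b : ℝ) (ν₀ ν₁ : Fin (d + 1)) : pauliLink (d := d) a b ν₀ ν₁ ν₀ = rotX a := by simp [pauliLink]
/-- `W_{ν₁} = e^{ibσ₂}` (`ν₀ ≠ ν₁`). [folklore] -/
theorem pauliLink_snd (a b : ℝ) {ν₀ ν₁ : Fin (d + 1)} (hν : ν₀ ≠ ν₁) : pauliLink (d := d) a b ν₀ ν₁ ν₁ = rotY b := by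
  simp [pauliLink, Ne.symm hν]
/-- `W_μ = 1` off the two curved directions. [folklore] -/
theorem pauliLink_of_ne (a b : ℝ) {ν₀ ν₁ μ : Fin (d + 1)} (h0 : μ ≠ ν₀) (h1 : μ ≠ ν₁) : pauliLink (d := d) a b ν₀ ν₁ μ = 1 := by
  simp [pauliLink, h0, h1]
/-- The Pauli link field is unitary. [folklore] -/
theorem pauliLink_mem_unitaryGroup (a b : ℝ) (ν₀ ν₁ μ : Fin (d + 1)) : pauliLink (d := d) a b ν₀ ν₁ μ ∈ Matrix.unitaryGroup (Fin 2) ℂ := by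
  unfold pauliLink
  split_ifs
  · exact rotX_mem_unitaryGroup a
  · exact rotY_mem_unitaryGroup b
  · exact Submonoid.one_mem _

variable [hK : ∀ μ, NeZero (K μ)]

omit hK in
/-- The plaquette of a CONSTANT link field is the same matrix at every site: `P(x,μ,ν) = W_μW_νW_μ^*W_ν^*`. [cite: King1986, (2.12) p.653] -/
theorem kingPlaq_kingConstLink {n : Type*} [Fintype n] (W : Fin (d + 1) → Matrix n n ℂ) (x : Tor K) (μ ν : Fin (d + 1)) :
    kingPlaq K (kingConstLink K W) x μ ν = W μ * W ν * (W μ)ᴴ * (W ν)ᴴ := rfl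

omit hK in
/-- `ABA^*B^* − 1 = (AB − BA)·A^*B^*` for unitary `A, B`: the plaquette defect IS the commutator, transported. [folklore] -/
theorem plaq_sub_one_eq {n : Type*} [Fintype n] [DecidableEq n] {A B : Matrix n n ℂ} (hA : A ∈ Matrix.unitaryGroup n ℂ) (hB : B ∈ Matrix.unitaryGroup n ℂ) :
    A * B * Aᴴ * Bᴴ - 1 = (A * B - B * A) * (Aᴴ * Bᴴ) := by
  have hAA : A * Aᴴ = 1 := by simpa only [Matrix.star_eq_conjTranspose] using Matrix.mem_unitaryGroup_iff.mp hA
  have hBB : B * Bᴴ = 1 := by simpa only [Matrix.star_eq_conjTranspose] using Matrix.mem_unitaryGroup_iff.mp hB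
  rw [sub_mul, Matrix.mul_assoc B A, ← Matrix.mul_assoc A Aᴴ Bᴴ, hAA, Matrix.one_mul, hBB, ← Matrix.mul_assoc (A * B) Aᴴ Bᴴ]

omit hK in
/-- THE PAULI PLAQUETTE DEFECT: `P − 1 = (−2i sin a sin b)·σ₃·(e^{iaσ₁})^*(e^{ibσ₂})^*`. [cite: King1986, (2.12) p.653] -/
theorem kingPlaq_pauli_sub_one (a b : ℝ) {ν₀ ν₁ : Fin (d + 1)} (hν : ν₀ ≠ ν₁) (x : Tor K) :
    kingPlaq K (kingConstLink K (pauliLink a b ν₀ ν₁)) x ν₀ ν₁ - 1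
      = ((-(2 : ℂ) * Complex.I * Real.sin a * Real.sin b) • pauliZ) * ((rotX a)ᴴ * (rotY b)ᴴ) := by
  rw [kingPlaq_kingConstLink, pauliLink_fst, pauliLink_snd a b hν, plaq_sub_one_eq (rotX_mem_unitaryGroup a) (rotY_mem_unitaryGroup b), rotX_mul_rotY_sub]

omit hK in
/-- ★★ **CONSTANT CURVATURE**: `‖Pu − u‖ = 2|sin a·sin b|·‖u‖` for EVERY `u ∈ ℂ²` at every site — the plaquette holonomy of the Pauli field rotates every vector by the same angle
`θ_P`, `sin(θ_P∕2) = |sin a sin b|` (Ϳ-c's holonomy-gap hypothesis with EQUALITY). [cite: King1986, (2.12) p.653; DodziukMathai2006, Cor 1.3 §1] -/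
theorem norm_kingPlaq_pauli_sub_self (a b : ℝ) {ν₀ ν₁ : Fin (d + 1)} (hν : ν₀ ≠ ν₁) (x : Tor K) (u : EuclideanSpace ℂ (Fin 2)) :
    ‖Matrix.toEuclideanLin (kingPlaq K (kingConstLink K (pauliLink a b ν₀ ν₁)) x ν₀ ν₁) u - u‖ = 2 * |Real.sin a * Real.sin b| * ‖u‖ := by
  set P := kingPlaq K (kingConstLink K (pauliLink a b ν₀ ν₁)) x ν₀ ν₁ with hP
  have h1 : Matrix.toEuclideanLin P u - u = Matrix.toEuclideanLin (P - 1) u := by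
    rw [map_sub, LinearMap.sub_apply, Matrix.toLpLin_one, LinearMap.id_apply]
  have hV : (rotX a)ᴴ * (rotY b)ᴴ ∈ Matrix.unitaryGroup (Fin 2) ℂ := by
    refine Submonoid.mul_mem _ ?_ ?_
    · simpa only [Matrix.star_eq_conjTranspose] using Unitary.star_mem (rotX_mem_unitaryGroup a)
    · simpa only [Matrix.star_eq_conjTranspose] using Unitary.star_mem (rotY_mem_unitaryGroup b)
  rw [h1, hP, kingPlaq_pauli_sub_one K a b hν x, Matrix.toLpLin_apply, ← Matrix.mulVec_mulVec, Matrix.smul_mulVec, WithLp.toLp_smul, norm_smul]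
  have h2 : ‖(toLp 2 (pauliZ *ᵥ (((rotX a)ᴴ * (rotY b)ᴴ) *ᵥ ofLp u)) : EuclideanSpace ℂ (Fin 2))‖ = ‖u‖ := by
    have e1 := norm_toEuclideanLin_of_mem_unitaryGroup pauliZ_mem_unitaryGroup (toLp 2 (((rotX a)ᴴ * (rotY b)ᴴ) *ᵥ ofLp u) : EuclideanSpace ℂ (Fin 2))
    have e2 := norm_toEuclideanLin_of_mem_unitaryGroup hV u
    rw [Matrix.toLpLin_apply, ofLp_toLp] at e1
    rw [Matrix.toLpLin_apply] at e2
    rw [e1, e2]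
  rw [h2]
  congr 1
  rw [norm_mul, norm_mul, norm_mul, norm_neg, Complex.norm_I, Complex.norm_real, Complex.norm_real, mul_one, abs_mul]
  norm_num
  ring

omit hK in
/-- ★★ **THE PLAQUETTE'S NUMERICAL RANGE IS ONE REAL POINT**: `Re⟪u, Pu⟫ = (1 − 2sin²a·sin²b)·‖u‖²` for every `u` (`= cos θ_P·‖u‖²`; from `‖Pu − u‖² = 2‖u‖² − 2Re⟪u,Pu⟫`, `P` unitary).
[cite: King1986, (2.12) p.653; DodziukMathai2006, Cor 1.3 §1] -/
theorem re_inner_kingPlaq_pauli (a b : ℝ) {ν₀ ν₁ : Fin (d + 1)} (hν : ν₀ ≠ ν₁) (x : Tor K) (u : EuclideanSpace ℂ (Fin 2)) :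
    RCLike.re ⟪u, Matrix.toEuclideanLin (kingPlaq K (kingConstLink K (pauliLink a b ν₀ ν₁)) x ν₀ ν₁) u⟫_ℂ
      = (1 - 2 * (Real.sin a) ^ 2 * (Real.sin b) ^ 2) * ‖u‖ ^ 2 := by
  set P := kingPlaq K (kingConstLink K (pauliLink a b ν₀ ν₁)) x ν₀ ν₁ with hP
  have hPu : ‖Matrix.toEuclideanLin P u‖ = ‖u‖ :=
    norm_toEuclideanLin_of_mem_unitaryGroup (kingPlaq_mem_unitaryGroup K (kingConstLink_mem_unitaryGroup K (pauliLink_mem_unitaryGroup a b ν₀ ν₁)) x ν₀ ν₁) u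
  have h := norm_kingPlaq_pauli_sub_self K a b hν x u
  rw [← hP] at h
  have hsq : ‖Matrix.toEuclideanLin P u - u‖ ^ 2 = (2 * |Real.sin a * Real.sin b| * ‖u‖) ^ 2 := by rw [h]
  rw [@norm_sub_sq ℂ, hPu, mul_pow, mul_pow, sq_abs, mul_pow] at hsq
  have hsym : RCLike.re ⟪Matrix.toEuclideanLin P u, u⟫_ℂ = RCLike.re ⟪u, Matrix.toEuclideanLin P u⟫_ℂ := by
    rw [← inner_conj_symm, RCLike.conj_re]
  rw [hsym] at hsq
  linarith [hsq]

end Plaquette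

/-! ## §3 PART Ϳ's plaquette road at the Pauli field (the quadratic benchmark) -/

section PlaqRoad

variable {d : ℕ} (K : Fin (d + 1) → ℕ) [hK : ∀ μ, NeZero (K μ)]

/-- ★★ **THE PLAQUETTE ROAD BY NAME** (PART Ϳ-c `re_quadForm_covLapF_ge_of_holonomy_gap` with `s = 2|sin a sin b|`, equality in its hypothesis):
`(m² + 2c·λ(1 − 2sin²a sin²b))·Σ_x‖v_x‖² ≤ Re⟨v,(−cΔ_W+m²)v⟩` for the Pauli field, `λ = plaqGap` (`λ(cos θ_P) = 2 − 2cos(θ_P∕4) ≤ θ_P²∕16`): a mass QUADRATIC in the curvature.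
[cite: DodziukMathai2006, Cor 1.3 §1; Balaban1985BackgroundPropagators, (3.23) p.394; King1986, (2.12) p.653, (4.4) p.670] -/
theorem re_quadForm_covLapF_pauliLink_ge_plaq {c : ℝ} (hc : 0 ≤ c) (m2 a b : ℝ) {ν₀ ν₁ : Fin (d + 1)} (hν : ν₀ ≠ ν₁) (v : Tor K × Fin 2 → ℂ) :
    (m2 + 2 * c * plaqGap (1 - 2 * (Real.sin a) ^ 2 * (Real.sin b) ^ 2)) * ∑ x, ‖fib K v x‖ ^ 2
      ≤ RCLike.re (star v ⬝ᵥ (covLapF K c m2 (kingConstLink K (pauliLink a b ν₀ ν₁)) *ᵥ v)) := by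
  have hs : (1 : ℝ) - (2 * |Real.sin a * Real.sin b|) ^ 2 / 2 = 1 - 2 * (Real.sin a) ^ 2 * (Real.sin b) ^ 2 := by
    rw [mul_pow, sq_abs, mul_pow]; ring
  rw [← hs]
  exact re_quadForm_covLapF_ge_of_holonomy_gap K hc m2 (kingConstLink_mem_unitaryGroup K (pauliLink_mem_unitaryGroup a b ν₀ ν₁)) hν (by positivity)
    (fun x u => (norm_kingPlaq_pauli_sub_self K a b hν x u).symm.le) v

end PlaqRoad

/-! ## §4 The fibre letters: one dressed direction, and the Bloch constraint -/

section FibreLetters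

/-- ★ The diagonal matrix element of a Hermitian matrix is real: `Im⟪ξ, σξ⟫ = 0`. [folklore] -/
theorem im_inner_toEuclideanLin_of_isHermitian {n : Type*} [Fintype n] [DecidableEq n] {σ : Matrix n n ℂ} (hσ : σ.IsHermitian) (ξ : EuclideanSpace ℂ n) :
    RCLike.im ⟪ξ, Matrix.toEuclideanLin σ ξ⟫_ℂ = 0 := by
  rw [EuclideanSpace.inner_eq_star_dotProduct, Matrix.ofLp_toLpLin, Matrix.toLin'_apply, dotProduct_comm]
  exact hσ.im_star_dotProduct_mulVec_self (ofLp ξ)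

/-- ★★ **ONE DRESSED DIRECTION**: for `W = cos a·1 + (i sin a)·σ` with `σ` Hermitian, `W` unitary, and a phase `|ψ| = 1`:
`‖ξ − ψ·Wξ‖² = 2(1 − Re ψ·cos a)·‖ξ‖² + 2·Im ψ·sin a·Re⟪ξ,σξ⟫` (`‖ψWξ‖ = ‖ξ‖`, `⟪ξ,Wξ⟫ = cos a‖ξ‖² + i sin a⟪ξ,σξ⟫` with `⟪ξ,σξ⟫` real).
[cite: Balaban1985BackgroundPropagators, (3.3) p.391; King1986, (4.4) p.670] -/
theorem norm_sq_sub_smul_rot {σ W : Matrix (Fin 2) (Fin 2) ℂ} (hσ : σ.IsHermitian) {a : ℝ} (hWeq : W = (Real.cos a : ℂ) • (1 : Matrix (Fin 2) (Fin 2) ℂ) + ((Real.sin a : ℂ) * Complex.I) • σ)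
    (hW : W ∈ Matrix.unitaryGroup (Fin 2) ℂ) {ψ : ℂ} (hψ : ‖ψ‖ = 1) (ξ : EuclideanSpace ℂ (Fin 2)) :
    ‖ξ - ψ • Matrix.toEuclideanLin W ξ‖ ^ 2
      = 2 * (1 - ψ.re * Real.cos a) * ‖ξ‖ ^ 2 + 2 * ψ.im * Real.sin a * RCLike.re ⟪ξ, Matrix.toEuclideanLin σ ξ⟫_ℂ := by
  have hreal : (⟪ξ, Matrix.toEuclideanLin σ ξ⟫_ℂ).im = 0 := im_inner_toEuclideanLin_of_isHermitian hσ ξ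
  have hWξ : ⟪ξ, Matrix.toEuclideanLin W ξ⟫_ℂ = (Real.cos a : ℂ) * ((‖ξ‖ : ℂ) ^ 2) + ((Real.sin a : ℂ) * Complex.I) * ⟪ξ, Matrix.toEuclideanLin σ ξ⟫_ℂ := by
    rw [hWeq, map_add, map_smul, map_smul, Matrix.toLpLin_one, LinearMap.add_apply, LinearMap.smul_apply, LinearMap.smul_apply, LinearMap.id_apply,
      inner_add_right, inner_smul_right, inner_smul_right, inner_self_eq_norm_sq_to_K]
    simp only [rclike_ofReal_complex]
  rw [@norm_sub_sq ℂ, norm_smul, hψ, one_mul, norm_toEuclideanLin_of_mem_unitaryGroup hW, inner_smul_right, hWξ]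
  have hz' : ⟪ξ, Matrix.toEuclideanLin σ ξ⟫_ℂ = (((⟪ξ, Matrix.toEuclideanLin σ ξ⟫_ℂ).re : ℝ) : ℂ) :=
    (Complex.conj_eq_iff_re.mp (Complex.conj_eq_iff_im.mpr hreal)).symm
  rw [hz']
  simp only [RCLike.re_to_complex, Complex.mul_re, Complex.mul_im, Complex.add_re, Complex.add_im, Complex.ofReal_re, Complex.ofReal_im, Complex.I_re, Complex.I_im,
    ← Complex.ofReal_pow]
  ring

/-- `‖ξ − ψ·e^{iaσ₁}ξ‖² = 2(1 − Re ψ cos a)‖ξ‖² + 2 Im ψ sin a·Re⟪ξ,σ₁ξ⟫`. [cite: Balaban1985BackgroundPropagators, (3.3) p.391] -/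
theorem norm_sq_sub_smul_rotX (a : ℝ) {ψ : ℂ} (hψ : ‖ψ‖ = 1) (ξ : EuclideanSpace ℂ (Fin 2)) :
    ‖ξ - ψ • Matrix.toEuclideanLin (rotX a) ξ‖ ^ 2
      = 2 * (1 - ψ.re * Real.cos a) * ‖ξ‖ ^ 2 + 2 * ψ.im * Real.sin a * RCLike.re ⟪ξ, Matrix.toEuclideanLin pauliX ξ⟫_ℂ :=
  norm_sq_sub_smul_rot isHermitian_pauliX (rotX_eq a) (rotX_mem_unitaryGroup a) hψ ξ

/-- `‖ξ − ψ·e^{ibσ₂}ξ‖² = 2(1 − Re ψ cos b)‖ξ‖² + 2 Im ψ sin b·Re⟪ξ,σ₂ξ⟫`. [cite: Balaban1985BackgroundPropagators, (3.3) p.391] -/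
theorem norm_sq_sub_smul_rotY (b : ℝ) {ψ : ℂ} (hψ : ‖ψ‖ = 1) (ξ : EuclideanSpace ℂ (Fin 2)) :
    ‖ξ - ψ • Matrix.toEuclideanLin (rotY b) ξ‖ ^ 2
      = 2 * (1 - ψ.re * Real.cos b) * ‖ξ‖ ^ 2 + 2 * ψ.im * Real.sin b * RCLike.re ⟪ξ, Matrix.toEuclideanLin pauliY ξ⟫_ℂ :=
  norm_sq_sub_smul_rot isHermitian_pauliY (rotY_eq b) (rotY_mem_unitaryGroup b) hψ ξ

/-- ★ THE BLOCH COMPONENT `⟨σ₁⟩_ξ = 2Re(ξ̄₀ξ₁)`. [folklore] -/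
theorem re_inner_pauliX (ξ : EuclideanSpace ℂ (Fin 2)) : RCLike.re ⟪ξ, Matrix.toEuclideanLin pauliX ξ⟫_ℂ = 2 * (conj (ξ 0) * ξ 1).re := by
  rw [EuclideanSpace.inner_eq_star_dotProduct, Matrix.ofLp_toLpLin, Matrix.toLin'_apply]
  simp only [dotProduct, Matrix.mulVec, Fin.sum_univ_two, pauliX, Pi.star_apply, RCLike.star_def, Matrix.of_apply, Matrix.cons_val', Matrix.cons_val_zero,
    Matrix.cons_val_one, Matrix.empty_val', Matrix.cons_val_fin_one, RCLike.re_to_complex]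
  have h1 : (ξ 0 * conj (ξ 1)).re = (conj (ξ 0) * ξ 1).re := by
    rw [← Complex.conj_re (ξ 0 * conj (ξ 1)), map_mul, Complex.conj_conj]
  simp only [zero_mul, one_mul, zero_add, add_zero, Complex.add_re]
  show (ξ.ofLp 1 * conj (ξ.ofLp 0) + ξ.ofLp 0 * conj (ξ.ofLp 1)).re = 2 * (conj (ξ.ofLp 0) * ξ.ofLp 1).re
  rw [Complex.add_re, mul_comm (ξ.ofLp 1), h1]
  ring

/-- ★ THE BLOCH COMPONENT `⟨σ₂⟩_ξ = 2Im(ξ̄₀ξ₁)`. [folklore] -/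
theorem re_inner_pauliY (ξ : EuclideanSpace ℂ (Fin 2)) : RCLike.re ⟪ξ, Matrix.toEuclideanLin pauliY ξ⟫_ℂ = 2 * (conj (ξ 0) * ξ 1).im := by
  rw [EuclideanSpace.inner_eq_star_dotProduct, Matrix.ofLp_toLpLin, Matrix.toLin'_apply]
  simp only [dotProduct, Matrix.mulVec, Fin.sum_univ_two, pauliY, Pi.star_apply, RCLike.star_def, Matrix.of_apply, Matrix.cons_val', Matrix.cons_val_zero,
    Matrix.cons_val_one, Matrix.empty_val', Matrix.cons_val_fin_one, RCLike.re_to_complex]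
  show ((0 * ξ.ofLp 0 + -Complex.I * ξ.ofLp 1) * conj (ξ.ofLp 0) + (Complex.I * ξ.ofLp 0 + 0 * ξ.ofLp 1) * conj (ξ.ofLp 1)).re = 2 * (conj (ξ.ofLp 0) * ξ.ofLp 1).im
  simp only [Complex.add_re, Complex.mul_re, Complex.mul_im, Complex.add_im, Complex.neg_re, Complex.neg_im, Complex.I_re, Complex.I_im, Complex.conj_re, Complex.conj_im,
    Complex.zero_re, Complex.zero_im]
  ring

/-- `‖ξ‖² = |ξ₀|² + |ξ₁|²`. [folklore] -/
theorem norm_sq_fin_two (ξ : EuclideanSpace ℂ (Fin 2)) : ‖ξ‖ ^ 2 = ‖ξ 0‖ ^ 2 + ‖ξ 1‖ ^ 2 := by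
  rw [EuclideanSpace.norm_sq_eq, Fin.sum_univ_two]

/-- ★★ **THE BLOCH CONSTRAINT**: `⟨σ₁⟩_ξ² + ⟨σ₂⟩_ξ² ≤ ‖ξ‖⁴` (`(2Re ξ̄₀ξ₁)² + (2Im ξ̄₀ξ₁)² = 4|ξ₀|²|ξ₁|² ≤ (|ξ₀|² + |ξ₁|²)²`). [folklore] -/
theorem bloch_sq_le (ξ : EuclideanSpace ℂ (Fin 2)) :
    (RCLike.re ⟪ξ, Matrix.toEuclideanLin pauliX ξ⟫_ℂ) ^ 2 + (RCLike.re ⟪ξ, Matrix.toEuclideanLin pauliY ξ⟫_ℂ) ^ 2 ≤ (‖ξ‖ ^ 2) ^ 2 := by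
  rw [re_inner_pauliX, re_inner_pauliY, norm_sq_fin_two]
  set w : ℂ := conj (ξ 0) * ξ 1 with hw
  have hw2 : ‖w‖ ^ 2 = ‖ξ 0‖ ^ 2 * ‖ξ 1‖ ^ 2 := by rw [hw, norm_mul, Complex.norm_conj, mul_pow]
  have hri : w.re ^ 2 + w.im ^ 2 = ‖w‖ ^ 2 := by rw [Complex.sq_norm, Complex.normSq_apply]; ring
  nlinarith [sq_nonneg (‖ξ 0‖ ^ 2 - ‖ξ 1‖ ^ 2), hri, hw2, sq_nonneg (‖ξ 0‖), sq_nonneg (‖ξ 1‖)]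

end FibreLetters

end Summit.QuantumFields.YangMills.BalabanUVNodes.N15KingModelRung.ConstantCurvature

end
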